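import Summits.PneNP.PneNP.Theorems.ChebyshevTracialDesignJuntaPatternLaw
import HarnessLib

/-!
# Cell pnp-psdrank, route `ChebyshevTracialDesign`: PATTERN AND JUNTA LEVEL PROFILES ARE SMOOTH — the pattern-law polynomial
# `P = 2^{-y}[X]_y·[(t−X)/2]_z·[N−(t+X)/2]_{x−y−z}/[N]_x` and every junta profile `Σ_B Λ(B) P_B` have ALL derivatives bounded on `[0, N]`:
# `|P^{(m)}(ξ)| ≤ C(x,m)·m!·N^{x−m}/[N]_x` (crux `TracialDecayExp20`, stmt-PneNP-19878)

Brick 110a (prover g20; eng MEMO-18 §5 (P2) «file the LEVEL-PROFILE SMOOTHNESS lemma — it is the engine», lit g30 `ExactDesignRemainder`, MEMO-23 §2).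
The design functional reads a cut function `G` at a matching `M` only through its LEVEL PROFILE `c ↦ Σ_{cc(U,M) = c} G(U) = T(N; c, i)·P_G(c)`
(`c + 2i = t`, `T(N;c,i) = C(N,c+i)C(c+i,i)2^c` the shell size; `…JuntaPatternLaw.junta_sum_law`). An EXACT design of degree `D` prices `P_G` at
`−P_G(0)` when `deg P_G ≤ D` (junta virtual positivity, `…JuntaVirtualPositivity`, juntas of size `≤ D`); beyond degree `D` the design error is the
Newton remainder `|Σ_c w_c P_G(c) + P_G(0)| ≤ B·C(T,D+1)·max_{[0,T]}|P_G^{(D+1)}|` (Literature `IsExactDesign.abs_levelSum_add_le_of_hasDerivAt`). This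
file supplies the derivative bounds:
* §1 **`iterate_derivative_linear_mul`** (`((aX+b)Q)^{(m+1)} = (aX+b)Q^{(m+1)} + (m+1)aQ^{(m)}`), **`abs_iterate_derivative_prod_linear_le`** — a
  product of `k` linear factors with slopes `≤ α` and values `≤ β` at `ξ` has `|m`-th derivative at `ξ| ≤ C(k,m)·m!·α^m·β^{k−m}` (Leibniz, induction
  on the factors; Pascal's rule).
* §2 **`pattern_poly_smooth`** — the pattern-law polynomial of a full local pattern (`x ≤ N` window edges, `y` crossing, `z` internal; range
  `2x ≤ t+2`, `2x + t ≤ 2N+2`, `t ≤ 2N`) of `…JuntaPatternLaw.pattern_poly_exists` (degree `≤ x`, `P(0) ≥ 0`, the level identity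
  `T(N−x; c−y, i−z) = T(N;c,i)·P(c)` — parts re-derived here verbatim, since the tree lemma is an `∃`) satisfies IN ADDITION
  `|P^{(m)}(ξ)| ≤ C(x,m)·m!·N^{x−m}/[N]_x` for all `m` and `ξ ∈ [0, N]`: its `x` linear factors `ξ − j`, `(t/2 − j) − ξ/2`, `(N − t/2 − j) − ξ/2` have
  slope `≤ 1` and modulus `≤ N` there. In particular `P^{(m)} ≡ 0` for `m > x`.
CONSEQUENCE (companion brick 110b `…JuntaRemainderPricing`: the junta sum law with derivative bounds, and the design pricing): juntas of ANY size `h`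
(`4h ≤ n`) are priced per matching, for every psd matching side and every dimension, at `≤ B·C(T,D+1)·C(h,D+1)(D+1)!·8^h·Λ_max/N^{D+1}` — zero for
`h ≤ D` (junta virtual positivity recovered), `n^{−(D+1)/4 + O(h/ln n)}` in the balanced Chebyshev regime `T ≍ √n`, `D ≍ n^{1/4}`: the first kernel
instance of the remainder engine (P2). The eng's measured `N^{−3/2}` per order for the H-SYMMETRIC class at `|H| ≍ n` is a cancellation BETWEEN
patterns (CLT smoothness of hypergeometric profiles) that a pattern-by-pattern bound does not see.
[cite: Rothvoss2017, §2 (PDF p. 6)] [cite: Grigoriev2001, Lemma 1.4 (PDF p. 8)] [cite: Agarwal2000DifferenceEquations, Remark 1.8.1 (1.8.8)]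
[cite: CoppersmithRivlin1992, Thm. (p. 970)]
Stature: support/instrument (kernel lane, no defs, axioms standard). WHAT THIS IS NOT: no statement about non-junta cut functions or about the
H-symmetric class at `|H| ≫ D`, no proof or refutation of `TracialDecayExp20`, nothing on psd rank of P_PM(K_n), no P-vs-NP content.
Supports stmt-PneNP-19878.
-/

set_option linter.dupNamespace false -- `Summit.PneNP.PneNP.…`: summit = sub-problem (D-0017)

noncomputable section

namespace Summit.PneNP.PneNP.Theorems.ChebyshevTracialDesignPatternProfileSmoothness

open Finset Polynomial
open Summit.PneNP.PneNP.Theorems.ChebyshevTracialDesignJunta (cast_descFactorial_eq_prod T_ratio_nat)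

/-! ### §1 Derivatives of a product of linear polynomials -/

/-- **Leibniz rule against a linear factor**: `((aX+b)·Q)^{(m+1)} = (aX+b)·Q^{(m+1)} + (m+1)a·Q^{(m)}`. [folklore] -/
theorem iterate_derivative_linear_mul (a b : ℝ) (Q : ℝ[X]) (m : ℕ) :
    derivative^[m + 1] ((C a * X + C b) * Q) =
      (C a * X + C b) * derivative^[m + 1] Q + C (((m + 1 : ℕ) : ℝ) * a) * derivative^[m] Q := by
  have hL : derivative (C a * X + C b) = C a := by simp
  induction m with
  | zero =>
      show derivative ((C a * X + C b) * Q) = (C a * X + C b) * derivative Q + C (((0 + 1 : ℕ) : ℝ) * a) * Q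
      rw [derivative_mul, hL]
      simp only [zero_add, Nat.cast_one, one_mul]
      ring
  | succ m ih =>
      have e1 : derivative (derivative^[m + 1] Q) = derivative^[m + 1 + 1] Q := (Function.iterate_succ_apply' derivative (m + 1) Q).symm
      have e2 : derivative (derivative^[m] Q) = derivative^[m + 1] Q := (Function.iterate_succ_apply' derivative m Q).symm
      rw [Function.iterate_succ_apply', ih, derivative_add, derivative_mul, hL, derivative_C_mul, e1, e2]
      simp only [Nat.cast_add, Nat.cast_one, map_mul, map_add, map_one, map_natCast]
      ring

/-- **Derivatives of a product of linear factors.** If `|a_i| ≤ α` and `|a_i ξ + b_i| ≤ β` for all `i ∈ s` (`α, β ≥ 0`), then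
`|(Π_{i∈s} (a_i X + b_i))^{(m)}(ξ)| ≤ C(|s|, m)·m!·α^m·β^{|s|−m}` for every `m`. [folklore] -/
theorem abs_iterate_derivative_prod_linear_le {ι : Type*} [DecidableEq ι] (s : Finset ι) (a b : ι → ℝ) (ξ α β : ℝ)
    (hα : 0 ≤ α) (hβ : 0 ≤ β) (ha : ∀ i ∈ s, |a i| ≤ α) (hb : ∀ i ∈ s, |a i * ξ + b i| ≤ β) (m : ℕ) :
    |(derivative^[m] (∏ i ∈ s, (C (a i) * X + C (b i)))).eval ξ| ≤
      ((s.card.choose m : ℕ) : ℝ) * (m.factorial : ℝ) * α ^ m * β ^ (s.card - m) := by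
  induction s using Finset.induction_on generalizing m with
  | empty =>
      rcases m with _ | m
      · simp
      · simp [iterate_derivative_one]
  | @insert i s hi ih =>
      have ha' : ∀ j ∈ s, |a j| ≤ α := fun j hj => ha j (mem_insert_of_mem hj)
      have hb' : ∀ j ∈ s, |a j * ξ + b j| ≤ β := fun j hj => hb j (mem_insert_of_mem hj)
      have hai : |a i| ≤ α := ha i (mem_insert_self _ _)
      have hbi : |a i * ξ + b i| ≤ β := hb i (mem_insert_self _ _)
      rw [prod_insert hi, card_insert_of_notMem hi]
      rcases m with _ | m
      · -- `m = 0`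
        simp only [Function.iterate_zero, id_eq, eval_mul, eval_add, eval_C, eval_X, Nat.choose_zero_right, Nat.cast_one,
          Nat.factorial_zero, pow_zero, one_mul, mul_one, Nat.sub_zero]
        have h0 := ih ha' hb' 0
        simp only [Function.iterate_zero, id_eq, Nat.choose_zero_right, Nat.cast_one, Nat.factorial_zero, pow_zero, one_mul,
          mul_one, Nat.sub_zero] at h0
        rw [abs_mul, pow_succ, mul_comm (β ^ s.card)]
        exact mul_le_mul hbi h0 (abs_nonneg _) hβ
      · -- `m + 1`
        rw [iterate_derivative_linear_mul, eval_add, eval_mul, eval_mul, eval_add, eval_mul, eval_C, eval_X, eval_C, eval_C]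
        have h1 := ih ha' hb' (m + 1)
        have h2 := ih ha' hb' m
        refine (abs_add_le _ _).trans ?_
        rw [abs_mul, abs_mul]
        -- first term
        have e1 : |a i * ξ + b i| * |(derivative^[m + 1] (∏ i ∈ s, (C (a i) * X + C (b i)))).eval ξ| ≤
            β * (((s.card.choose (m + 1) : ℕ) : ℝ) * ((m + 1).factorial : ℝ) * α ^ (m + 1) * β ^ (s.card - (m + 1))) :=
          mul_le_mul hbi h1 (abs_nonneg _) hβ
        -- second term
        have e2 : |(((m + 1 : ℕ) : ℝ)) * a i| * |(derivative^[m] (∏ i ∈ s, (C (a i) * X + C (b i)))).eval ξ| ≤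
            (((m + 1 : ℕ) : ℝ) * α) * (((s.card.choose m : ℕ) : ℝ) * (m.factorial : ℝ) * α ^ m * β ^ (s.card - m)) := by
          refine mul_le_mul ?_ h2 (abs_nonneg _) (by positivity)
          rw [abs_mul, Nat.abs_cast]
          exact mul_le_mul_of_nonneg_left hai (Nat.cast_nonneg _)
        refine (add_le_add e1 e2).trans ?_
        -- combinatorics: `β·C(k,m+1)(m+1)!α^{m+1}β^{k-m-1} + (m+1)α·C(k,m)m!α^mβ^{k-m} ≤ C(k+1,m+1)(m+1)!α^{m+1}β^{k-m}`
        have hfac : (((m + 1).factorial : ℕ) : ℝ) = ((m + 1 : ℕ) : ℝ) * (m.factorial : ℝ) := by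
          rw [Nat.factorial_succ, Nat.cast_mul]
        have hchoose : (((s.card + 1).choose (m + 1) : ℕ) : ℝ) = ((s.card.choose m : ℕ) : ℝ) + ((s.card.choose (m + 1) : ℕ) : ℝ) := by
          rw [Nat.choose_succ_succ, Nat.cast_add]
        have hsub : s.card + 1 - (m + 1) = s.card - m := by omega
        rw [hsub, hchoose]
        rcases le_or_gt (m + 1) s.card with hle | hlt
        · have hpow : β * β ^ (s.card - (m + 1)) = β ^ (s.card - m) := by
            rw [← pow_succ', show s.card - (m + 1) + 1 = s.card - m by omega]
          calc β * (((s.card.choose (m + 1) : ℕ) : ℝ) * ((m + 1).factorial : ℝ) * α ^ (m + 1) * β ^ (s.card - (m + 1))) +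
                (((m + 1 : ℕ) : ℝ) * α) * (((s.card.choose m : ℕ) : ℝ) * (m.factorial : ℝ) * α ^ m * β ^ (s.card - m))
              = (((s.card.choose (m + 1) : ℕ) : ℝ) * ((m + 1).factorial : ℝ) * α ^ (m + 1)) * (β * β ^ (s.card - (m + 1))) +
                ((s.card.choose m : ℕ) : ℝ) * ((((m + 1 : ℕ) : ℝ)) * (m.factorial : ℝ)) * (α * α ^ m) * β ^ (s.card - m) := by ring
            _ = (((s.card.choose m : ℕ) : ℝ) + ((s.card.choose (m + 1) : ℕ) : ℝ)) * ((m + 1).factorial : ℝ) * α ^ (m + 1) *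
                  β ^ (s.card - m) := by rw [hpow, ← hfac, ← pow_succ']; ring
            _ ≤ _ := le_refl _
        · have hz : ((s.card.choose (m + 1) : ℕ) : ℝ) = 0 := by
            rw [Nat.choose_eq_zero_of_lt hlt, Nat.cast_zero]
          rw [hz, hfac]
          have : β * ((0 : ℝ) * (((m + 1 : ℕ) : ℝ) * (m.factorial : ℝ)) * α ^ (m + 1) * β ^ (s.card - (m + 1))) = 0 := by ring
          rw [this, zero_add, pow_succ]
          apply le_of_eq; ring

/-! ### §2 The pattern-law polynomial together with bounds on all its derivatives on `[0, N]` -/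

/-- **PATTERN PROFILES ARE SMOOTH.** The pattern-law polynomial of a full local pattern with `x ≤ N` window edges, `y` crossing and `z` internal
(`…JuntaPatternLaw.pattern_poly_exists`: `P = 2^{-y}[X]_y · ∏_{j<z}((t−X)/2 − j) · ∏_{j<x−y−z}(N − (t+X)/2 − j) / [N]_x`, of degree `≤ x`, with
`P(0) ≥ 0` and `T(N−x; c−y, i−z) = T(N; c, i)·P(c)` along `c + 2i = t`, in the range `2x ≤ t + 2`, `2x + t ≤ 2N + 2`, `t ≤ 2N`) satisfies, for
every order `m` and every `ξ ∈ [0, N]`: `|P^{(m)}(ξ)| ≤ C(x,m)·m!·N^{x−m}/[N]_x` — it is a product of `x` linear factors of slope `≤ 1` and size `≤ N`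
on `[0, N]`, divided by `2^y [N]_x`. In particular `P^{(m)} ≡ 0` for `m > x`. (Parts 1–3 adapted from `pattern_poly_exists`, same tree.) [folklore] -/
theorem pattern_poly_smooth (N t : ℕ) {x y z : ℕ} (hx : x ≤ N) (hyz : y + z ≤ x)
    (ht : 2 * x ≤ t + 2) (hn : 2 * x + t ≤ 2 * N + 2) (htN : t ≤ 2 * N) :
    ∃ P : Polynomial ℝ, P.natDegree ≤ x ∧ 0 ≤ P.eval 0 ∧
      (∀ c i : ℕ, c + 2 * i = t →
        (((if y ≤ c ∧ z ≤ i then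
            (N - x).choose (c - y + (i - z)) * (c - y + (i - z)).choose (i - z) * 2 ^ (c - y) else 0 : ℕ)) : ℝ) =
          ((N.choose (c + i) * (c + i).choose i * 2 ^ c : ℕ) : ℝ) * P.eval (c : ℝ)) ∧
      ∀ (m : ℕ) (ξ : ℝ), 0 ≤ ξ → ξ ≤ N →
        |(derivative^[m] P).eval ξ| ≤ ((x.choose m : ℕ) : ℝ) * (m.factorial : ℝ) * (N : ℝ) ^ (x - m) / (N.descFactorial x : ℝ) := by
  set κ : ℝ := ((2 : ℝ) ^ y * (N.descFactorial x : ℝ))⁻¹ with hκ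
  have hNx : 0 < (N.descFactorial x : ℝ) := by
    have : N.descFactorial x ≠ 0 := fun h0 => by
      rw [Nat.descFactorial_eq_zero_iff_lt] at h0; omega
    positivity
  have hκ0 : 0 ≤ κ := by rw [hκ]; positivity
  refine ⟨C κ * (∏ j ∈ range y, (X - C (j : ℝ))) * (∏ j ∈ range z, (C ((t : ℝ) / 2 - j) - C (1 / 2) * X)) *
      ∏ j ∈ range (x - y - z), (C ((N : ℝ) - (t : ℝ) / 2 - j) - C (1 / 2) * X), ?_, ?_, ?_, ?_⟩
  · -- degree
    have h1 : (∏ j ∈ range y, (X - C (j : ℝ))).natDegree ≤ y := by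
      refine (natDegree_prod_le _ _).trans ?_
      refine (sum_le_sum fun (j : ℕ) _ => (natDegree_X_sub_C ((j : ℕ) : ℝ)).le).trans ?_
      simp
    have hlin : ∀ a : ℝ, (C a - C (1 / 2 : ℝ) * X).natDegree ≤ 1 := fun a =>
      (natDegree_sub_le _ _).trans (max_le (by simp) ((natDegree_C_mul_le _ _).trans natDegree_X_le))
    have h2 : (∏ j ∈ range z, (C ((t : ℝ) / 2 - j) - C (1 / 2) * X)).natDegree ≤ z := by
      refine (natDegree_prod_le _ _).trans ?_
      refine (sum_le_sum fun j _ => hlin _).trans ?_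
      simp
    have h3 : (∏ j ∈ range (x - y - z), (C ((N : ℝ) - (t : ℝ) / 2 - j) - C (1 / 2) * X)).natDegree ≤ x - y - z := by
      refine (natDegree_prod_le _ _).trans ?_
      refine (sum_le_sum fun j _ => hlin _).trans ?_
      simp
    refine (natDegree_mul_le.trans (add_le_add (natDegree_mul_le.trans (add_le_add
      ((natDegree_C_mul_le _ _).trans h1) h2)) h3)).trans ?_
    omega
  · -- value at the virtual level
    simp only [eval_mul, eval_C, eval_prod, eval_sub, eval_X, mul_zero, sub_zero]
    rcases Nat.eq_zero_or_pos y with hy0 | hy0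
    · subst hy0
      simp only [range_zero, prod_empty, mul_one, Nat.sub_zero]
      refine mul_nonneg (mul_nonneg hκ0 (prod_nonneg fun j hj => ?_)) (prod_nonneg fun j hj => ?_)
      · have := mem_range.1 hj
        have : (j : ℝ) ≤ (t : ℝ) / 2 := by
          rw [le_div_iff₀ (by norm_num : (0:ℝ) < 2)]
          exact_mod_cast (by omega : j * 2 ≤ t)
        linarith
      · have := mem_range.1 hj
        have : (j : ℝ) + (t : ℝ) / 2 ≤ N := by
          have h' : 2 * j + t ≤ 2 * N := by omega
          have h'' : (2 : ℝ) * j + t ≤ 2 * N := by exact_mod_cast h'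
          linarith
        linarith
    · have : ∏ j ∈ range y, ((0 : ℝ) - (j : ℝ)) = 0 :=
        prod_eq_zero (mem_range.2 hy0) (by simp)
      rw [this]
      simp
  · -- the identity at level c
    intro c i hci
    have evC : ∀ r : ℝ, ((∏ j ∈ range z, (C ((t : ℝ) / 2 - j) - C (1 / 2) * X)).eval r) =
        ∏ j ∈ range z, (((t : ℝ) - r) / 2 - j) := fun r => by
      rw [eval_prod]; exact prod_congr rfl fun j _ => by simp; ring
    have evE : ∀ r : ℝ, ((∏ j ∈ range (x - y - z), (C ((N : ℝ) - (t : ℝ) / 2 - j) - C (1 / 2) * X)).eval r) =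
        ∏ j ∈ range (x - y - z), ((N : ℝ) - ((t : ℝ) + r) / 2 - j) := fun r => by
      rw [eval_prod]; exact prod_congr rfl fun j _ => by simp; ring
    have evY : ∀ r : ℝ, ((∏ j ∈ range y, (X - C (j : ℝ))).eval r) = ∏ j ∈ range y, (r - j) := fun r => by
      rw [eval_prod]; exact prod_congr rfl fun j _ => by simp
    rw [eval_mul, eval_mul, eval_mul, eval_C, evY, evC, evE]
    have hti : ((t : ℝ) - c) / 2 = i := by
      have : (t : ℝ) = c + 2 * i := by exact_mod_cast hci.symm
      rw [this]; ring
    have htc : ((t : ℝ) + c) / 2 = (c : ℝ) + i := by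
      have : (t : ℝ) = c + 2 * i := by exact_mod_cast hci.symm
      rw [this]; ring
    rw [hti, htc]
    by_cases hyc : y ≤ c
    · by_cases hzi : z ≤ i
      · rw [if_pos ⟨hyc, hzi⟩]
        by_cases hciN : c + i ≤ N
        · by_cases he : x - y - z ≤ N - c - i
          · -- the non-degenerate case: the ℕ identity
            have key := T_ratio_nat hx hyz hyc hzi hciN he
            have keyR : (((N - x).choose (c - y + (i - z)) * (c - y + (i - z)).choose (i - z) * 2 ^ (c - y) : ℕ) : ℝ) *
                ((2 : ℝ) ^ y * (N.descFactorial x : ℝ)) =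
                ((N.choose (c + i) * (c + i).choose i * 2 ^ c : ℕ) : ℝ) *
                  ((c.descFactorial y : ℝ) * (i.descFactorial z : ℝ) * ((N - c - i).descFactorial (x - y - z) : ℝ)) := by
              exact_mod_cast key
            have h2y : (0 : ℝ) < (2 : ℝ) ^ y * (N.descFactorial x : ℝ) := by positivity
            have keyR' := (eq_div_iff h2y.ne').2 keyR
            rw [keyR', cast_descFactorial_eq_prod hyc, cast_descFactorial_eq_prod hzi,
              cast_descFactorial_eq_prod he, hκ]
            have : ((N - c - i : ℕ) : ℝ) = (N : ℝ) - ((c : ℝ) + i) := by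
              rw [Nat.sub_sub, Nat.cast_sub hciN, Nat.cast_add]
            rw [this]
            field_simp
          · -- too many external window edges: both sides vanish
            have he' := not_le.1 he
            have hL : N - x < c - y + (i - z) := by omega
            rw [Nat.choose_eq_zero_of_lt hL]
            have hmem : N - c - i ∈ range (x - y - z) := mem_range.2 he'
            have h0 : ∏ j ∈ range (x - y - z), ((N : ℝ) - ((c : ℝ) + i) - j) = 0 := by
              refine prod_eq_zero hmem ?_
              have : ((N - c - i : ℕ) : ℝ) = (N : ℝ) - ((c : ℝ) + i) := by
                rw [Nat.sub_sub, Nat.cast_sub hciN, Nat.cast_add]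
              rw [← this]; ring
            rw [h0]; simp
        · -- `c + i > N`: both sides vanish
          have hciN' := not_le.1 hciN
          have hL : N - x < c - y + (i - z) := by omega
          rw [Nat.choose_eq_zero_of_lt hL, Nat.choose_eq_zero_of_lt hciN']
          simp
      · -- `z > i`
        rw [if_neg (fun h => hzi h.2)]
        have h0 : ∏ j ∈ range z, ((i : ℝ) - j) = 0 := prod_eq_zero (mem_range.2 (not_le.1 hzi)) (by simp)
        rw [h0]; simp
    · -- `y > c`
      rw [if_neg (fun h => hyc h.1)]
      have h0 : ∏ j ∈ range y, ((c : ℝ) - j) = 0 := prod_eq_zero (mem_range.2 (not_le.1 hyc)) (by simp)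
      rw [h0]; simp
  · -- smoothness: the product of `x` linear factors of slope `≤ 1` and size `≤ N` on `[0, N]`
    intro m ξ hξ0 hξN
    -- one index type for the three blocks of factors
    set a : ℕ ⊕ (ℕ ⊕ ℕ) → ℝ := Sum.elim (fun _ : ℕ => (1 : ℝ)) (Sum.elim (fun _ : ℕ => -(1 / 2 : ℝ)) (fun _ : ℕ => -(1 / 2 : ℝ)))
      with ha_def
    set b : ℕ ⊕ (ℕ ⊕ ℕ) → ℝ := Sum.elim (fun j : ℕ => -(j : ℝ))
      (Sum.elim (fun j : ℕ => (t : ℝ) / 2 - j) (fun j : ℕ => (N : ℝ) - (t : ℝ) / 2 - j)) with hb_def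
    set S : Finset (ℕ ⊕ (ℕ ⊕ ℕ)) := (range y).disjSum ((range z).disjSum (range (x - y - z))) with hS
    have hY : ∏ j ∈ range y, (X - C (j : ℝ)) = ∏ j ∈ range y, (C (a (Sum.inl j)) * X + C (b (Sum.inl j))) :=
      prod_congr rfl fun j _ => by
        rw [ha_def, hb_def]; simp only [Sum.elim_inl, map_one, one_mul, map_neg, sub_eq_add_neg]
    have hZ : ∏ j ∈ range z, (C ((t : ℝ) / 2 - j) - C (1 / 2) * X) =
        ∏ j ∈ range z, (C (a (Sum.inr (Sum.inl j))) * X + C (b (Sum.inr (Sum.inl j)))) :=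
      prod_congr rfl fun j _ => by
        rw [ha_def, hb_def]; simp only [Sum.elim_inr, Sum.elim_inl, map_neg, map_sub]; ring
    have hW : ∏ j ∈ range (x - y - z), (C ((N : ℝ) - (t : ℝ) / 2 - j) - C (1 / 2) * X) =
        ∏ j ∈ range (x - y - z), (C (a (Sum.inr (Sum.inr j))) * X + C (b (Sum.inr (Sum.inr j)))) :=
      prod_congr rfl fun j _ => by
        rw [ha_def, hb_def]; simp only [Sum.elim_inr, map_neg, map_sub]; ring
    have hprod : (∏ j ∈ range y, (X - C (j : ℝ))) * (∏ j ∈ range z, (C ((t : ℝ) / 2 - j) - C (1 / 2) * X)) *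
        (∏ j ∈ range (x - y - z), (C ((N : ℝ) - (t : ℝ) / 2 - j) - C (1 / 2) * X)) = ∏ k ∈ S, (C (a k) * X + C (b k)) := by
      rw [hS, prod_disjSum, prod_disjSum, hY, hZ, hW, mul_assoc]
    have hScard : S.card = x := by
      rw [hS, card_disjSum, card_disjSum, card_range, card_range, card_range]; omega
    have hN0 : (0 : ℝ) ≤ N := Nat.cast_nonneg N
    have ha : ∀ k ∈ S, |a k| ≤ 1 := by
      intro k _
      rw [ha_def]
      rcases k with j | j | j <;> simp only [Sum.elim_inl, Sum.elim_inr] <;> norm_num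
    have htN' : (t : ℝ) ≤ 2 * N := by exact_mod_cast htN
    have hb : ∀ k ∈ S, |a k * ξ + b k| ≤ N := by
      intro k hk
      rw [hS] at hk
      rcases k with j | j | j
      · -- `ξ - j`, `j < y ≤ x ≤ N`
        have hj : j < y := by simpa using hk
        have hjN : (j : ℝ) ≤ N := by exact_mod_cast (by omega : j ≤ N)
        have hj0 : (0 : ℝ) ≤ j := Nat.cast_nonneg j
        rw [ha_def, hb_def]; simp only [Sum.elim_inl, one_mul]
        rw [abs_le]; constructor <;> linarith
      · -- `t/2 - j - ξ/2`, `j < z`, `2z ≤ t + 2`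
        have hj : j < z := by simpa using hk
        have hjt : (2 : ℝ) * j ≤ t := by exact_mod_cast (by omega : 2 * j ≤ t)
        have hj0 : (0 : ℝ) ≤ j := Nat.cast_nonneg j
        rw [ha_def, hb_def]; simp only [Sum.elim_inr, Sum.elim_inl]
        rw [abs_le]; constructor <;> linarith
      · -- `N - t/2 - j - ξ/2`, `j < x - y - z`, `2x + t ≤ 2N + 2`
        have hj : j < x - y - z := by simpa using hk
        have hjt : (2 : ℝ) * j + t ≤ 2 * N := by exact_mod_cast (by omega : 2 * j + t ≤ 2 * N)
        have hj0 : (0 : ℝ) ≤ j := Nat.cast_nonneg j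
        have ht0 : (0 : ℝ) ≤ t := Nat.cast_nonneg t
        rw [ha_def, hb_def]; simp only [Sum.elim_inr]
        rw [abs_le]; constructor <;> linarith
    have key := abs_iterate_derivative_prod_linear_le S a b ξ 1 N zero_le_one hN0 ha hb m
    rw [one_pow, mul_one, hScard] at key
    rw [mul_assoc (C κ), mul_assoc (C κ), hprod, iterate_derivative_C_mul, eval_mul, eval_C, abs_mul, abs_of_nonneg hκ0]
    calc κ * |(derivative^[m] (∏ k ∈ S, (C (a k) * X + C (b k)))).eval ξ|
        ≤ κ * (((x.choose m : ℕ) : ℝ) * (m.factorial : ℝ) * (N : ℝ) ^ (x - m)) := mul_le_mul_of_nonneg_left key hκ0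
      _ ≤ (N.descFactorial x : ℝ)⁻¹ * (((x.choose m : ℕ) : ℝ) * (m.factorial : ℝ) * (N : ℝ) ^ (x - m)) := by
          refine mul_le_mul_of_nonneg_right ?_ (by positivity)
          rw [hκ, mul_inv]
          refine mul_le_of_le_one_left (inv_nonneg.2 hNx.le) ?_
          rw [inv_le_one_iff₀]
          exact Or.inr (one_le_pow₀ (by norm_num))
      _ = _ := by rw [div_eq_inv_mul]

end Summit.PneNP.PneNP.Theorems.ChebyshevTracialDesignPatternProfileSmoothness
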